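import Mathlib
import Literature.Analysis.ODE.VariationalEnclosureNaturalExtension
import HarnessLib

/-!
# Linearity of the variational equation: `ψ(t, x, M) = ψ(t, x, Id) · M` and the composition of C¹ enclosures

The equation for `V` in the variational system `y' = f(y)`, `V' = Df(y) ∘ V` is LINEAR in `V`.
Hence (Teschl 2012 §3.4: Theorem 3.9, the principal matrix solution (3.83) and the identity
(3.88) `Π(t,t₁)Π(t₁,t₀) = Π(t,t₀)` "since both sides solve `Π̇ = A(t)Π` and coincide for
`t = t₁`"; "if `U(t)` is a matrix solution, so is `U(t)C`") the solution from the initial matrix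
`M` is the solution from `Id` composed with `M`:
`ψ(t, x, M) = ψ(t, x, Id) · M` — Walawska–Wilczak 2016 §2.1, "the key observation … the
equation for `V` is linear in `V`, which implies
`ψ(t_k + h_k, x₀, V₀) = ψ(h_k, φ(t_k, x₀), Id) · ψ(t_k, x₀, V₀)`", whence the inclusion
`ψ(t_k + h_k, [x₀], [V₀]) ⊂ ψ(h_k, [x_k], Id) · [V_k]` and "it is sufficient to use `Id` as an
initial condition for the variational equations when computing a rough enclosure".  This is
what lets a `C¹` integrator (and the cert/2 verifier of `cap.ode`) propagate Jacobian
enclosures across steps by INTERVAL MATRIX PRODUCTS of per-step enclosures computed from `Id`.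

## Contents

* `linearODE_eqOn_Icc` — Grönwall uniqueness for `J' = A(t) ∘ J` on `[0, h]` with bounded
  coefficients (Teschl Theorem 3.9);
* `hasDerivWithinAt_clm_comp_const`, `linearODE_comp_const` — a matrix solution composed on
  the right with a constant operator is a matrix solution;
* `linearODE_eq_comp` — every solution `J̃` equals `J(t) ∘ J̃(0)` where `J` is the solution from
  `Id` (`ψ(t,x,M) = ψ(t,x,Id)·M`, Teschl (3.88));
* `clm_comp_apply_single`, `comp_single_mem_imatmul` — the entries of a composition are the
  matrix product of the entries, hence lie in the interval matrix product of entrywise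
  enclosures (Neumaier 1990 Proposition 3.1.2: `{ÃB̃ | Ã ∈ A, B̃ ∈ B} ⊆ AB`);
* `variationalEnclosure_comp_intervalTest_smoothOn_local` — under the box-data hypotheses of
  `variationalEnclosure_step_intervalTest_smoothOn_local` (the `C¹` HOE test passed with
  initial matrix `Id`), for every `x ∈ W` and EVERY initial matrix `M`: a solution pair from
  `(x, M)` exists on `[0, h]`, and every solution pair `(z̃, J̃)` from `(x, M)` satisfies
  `z̃ t ∈ S` and `J̃ t = J ∘ M` with `J ∈ VV`, `J = ∑_{j<K} t^j Φ_j'(x) + t^K N`, `N ∈ NN`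
  (entrywise) — so `J̃ t ∈ VV · MM` and `J̃ t ∈ (∑_{j<K} T^j EV_j + T^K NN) · MM` whenever
  `M ∈ MM` (`comp_single_mem_imatmul`): Walawska–Wilczak's (eq. ψ-inclusion);
* `variationalEnclosure_comp_imatmul_smoothOn_local` — the interval-matrix-product form;
* `variationalEnclosure_comp_naturalExtension_polynomial` — the same for a polynomial field
  with all interval data computed by natural interval extension
  (`VariationalEnclosureNaturalExtension.lean`).

## References

* G. Teschl, *Ordinary Differential Equations and Dynamical Systems*, GSM 140, AMS 2012, §3.4:
  Theorem 3.9, eq. (3.83), Theorem 3.10, eq. (3.88) (book pp. 81–83). [Teschl2012]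
* I. Walawska, D. Wilczak, *An implicit algorithm for validated enclosures of the solutions to
  variational equations for ODEs*, Appl. Math. Comput. 291 (2016) (arXiv:1509.07388), §2.1
  (linearity identity and the inclusion `ψ(t_k+h_k,[x₀],[V₀]) ⊂ ψ(h_k,[x_k],Id)·[V_k]`).
  [WalawskaWilczak2016]
* P. Zgliczyński, *C¹ Lohner algorithm*, Found. Comput. Math. 2 (2002) 429–465. [Zgliczynski2002C1Lohner]
* A. Neumaier, *Interval Methods for Systems of Equations*, Cambridge UP 1990, §3.1
  Proposition 3.1.2 (6). [Neumaier1991]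
-/

noncomputable section

open Set Metric Filter Topology TopologicalSpace NonemptyInterval

open scoped NNReal ContDiff

namespace Literature.Analysis.ODE

/-! ### The linear matrix equation `J' = A(t) ∘ J` -/

section Linear

variable {E : Type*} [NormedAddCommGroup E] [NormedSpace ℝ E]

/-- **Uniqueness for the linear equation `J' = A(t) ∘ J`** on `[0, h]` with bounded coefficients
(Teschl 2012 Theorem 3.9, via Grönwall's inequality — here `norm_sub_le_of_linear` of
`FlowWithin.lean`): two solutions with the same initial value coincide.
[cite: Teschl2012, §3.4 Theorem 3.9] -/
theorem linearODE_eqOn_Icc {A : ℝ → E →L[ℝ] E} {h M : ℝ} {J₁ J₂ : ℝ → E →L[ℝ] E}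
    (hJ₁ : ∀ t ∈ Icc 0 h, HasDerivWithinAt J₁ ((A t).comp (J₁ t)) (Icc 0 h) t)
    (hJ₂ : ∀ t ∈ Icc 0 h, HasDerivWithinAt J₂ ((A t).comp (J₂ t)) (Icc 0 h) t)
    (hM : ∀ t ∈ Ico 0 h, ‖A t‖ ≤ M) (h0 : J₁ 0 = J₂ 0) : EqOn J₁ J₂ (Icc 0 h) := by
  intro t ht
  have hc : ContinuousOn J₂ (Icc 0 h) := fun s hs => (hJ₂ s hs).continuousWithinAt
  obtain ⟨P, hP⟩ := isCompact_Icc.exists_bound_of_continuousOn hc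
  have key := norm_sub_le_of_linear hJ₁ hJ₂ hM (fun s _ => by simp) (fun s hs =>
    hP s (Ico_subset_Icc_self hs)) le_rfl t ht
  rw [h0, sub_self, norm_zero, zero_mul, gronwallBound_ε0_δ0] at key
  exact sub_eq_zero.1 (norm_le_zero_iff.1 key)

/-- Right composition with a constant operator commutes with differentiation:
`(J ∘ M)' = J' ∘ M`. [cite: Teschl2012, §3.4 after eq. (3.89) ("if U(t) is a matrix solution, so is U(t)C")] -/
theorem hasDerivWithinAt_clm_comp_const {J : ℝ → E →L[ℝ] E} {J' : E →L[ℝ] E} {s : Set ℝ}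
    {t : ℝ} (hJ : HasDerivWithinAt J J' s t) (M : E →L[ℝ] E) :
    HasDerivWithinAt (fun t => (J t).comp M) (J'.comp M) s t := by
  simpa using hJ.clm_comp (hasDerivWithinAt_const t s M)

/-- **A matrix solution composed with a constant operator is a matrix solution**: if `J` solves
`J' = A(t) ∘ J` on `s` then so does `t ↦ J(t) ∘ M`.
[cite: Teschl2012, §3.4 after eq. (3.89) ("if U(t) is a matrix solution, so is U(t)C")] -/
theorem linearODE_comp_const {A J : ℝ → E →L[ℝ] E} {s : Set ℝ}
    (hJ : ∀ t ∈ s, HasDerivWithinAt J ((A t).comp (J t)) s t) (M : E →L[ℝ] E) :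
    ∀ t ∈ s, HasDerivWithinAt (fun t => (J t).comp M) ((A t).comp ((J t).comp M)) s t := by
  intro t ht
  have h := hasDerivWithinAt_clm_comp_const (hJ t ht) M
  rwa [ContinuousLinearMap.comp_assoc] at h

/-- **`ψ(t, x, M) = ψ(t, x, Id) · M`** (Teschl 2012 (3.88): both sides solve `Π̇ = A(t)Π` and
coincide at the initial time; Walawska–Wilczak 2016 §2.1, linearity of the variational equation
in `V`): if `J` solves `J' = A(t) ∘ J` on `[0, h]` with `J 0 = Id` and the coefficients are
bounded, then EVERY solution `J̃` of the same equation satisfies `J̃ t = J t ∘ J̃ 0`.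
[cite: Teschl2012, §3.4 Theorem 3.9 and eq. (3.88)]
[cite: WalawskaWilczak2016, §2.1 (ψ(t_k+h_k,x₀,V₀) = ψ(h_k,φ(t_k,x₀),Id)·ψ(t_k,x₀,V₀))] -/
theorem linearODE_eq_comp {A : ℝ → E →L[ℝ] E} {h M : ℝ} {J Jt : ℝ → E →L[ℝ] E}
    (hJ : ∀ t ∈ Icc 0 h, HasDerivWithinAt J ((A t).comp (J t)) (Icc 0 h) t) (hJ0 : J 0 = 1)
    (hJt : ∀ t ∈ Icc 0 h, HasDerivWithinAt Jt ((A t).comp (Jt t)) (Icc 0 h) t)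
    (hM : ∀ t ∈ Ico 0 h, ‖A t‖ ≤ M) : ∀ t ∈ Icc 0 h, Jt t = (J t).comp (Jt 0) :=
  fun t ht => linearODE_eqOn_Icc hJt (linearODE_comp_const hJ (Jt 0)) hM
    (show Jt 0 = (J 0).comp (Jt 0) by
      rw [hJ0, ContinuousLinearMap.one_def, ContinuousLinearMap.id_comp]) ht

end Linear

/-! ### Entries of a composition and the interval matrix product -/

section Matrix

variable {ι : Type*} [Fintype ι] [DecidableEq ι]

/-- The entries of a composition of linear maps of `ℝ^ι` are the matrix product of the
entries: `(A ∘ M) e_j · e_i = ∑_k (A e_k)_i (M e_j)_k`.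
[cite: Neumaier1991, §3.1 (matrix product, before Proposition 3.1.1)] -/
theorem clm_comp_apply_single (A M : (ι → ℝ) →L[ℝ] (ι → ℝ)) (i j : ι) :
    (A.comp M) (Pi.single j 1) i = ∑ k, A (Pi.single k 1) i * M (Pi.single j 1) k := by
  have h := congrFun (congrFun (LinearMap.toMatrix'_comp (A : (ι → ℝ) →ₗ[ℝ] (ι → ℝ))
    (M : (ι → ℝ) →ₗ[ℝ] (ι → ℝ))) i) j
  simpa [Matrix.mul_apply, LinearMap.toMatrix'_apply] using h

/-- **Entrywise enclosures compose by the interval matrix product** (Neumaier 1990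
Proposition 3.1.2 (6): `{ÃB̃ | Ã ∈ A, B̃ ∈ B} ⊆ AB`): if the entries of `A` lie in `AA` and those
of `M` in `MM`, the entries of `A ∘ M` lie in `AA · MM` — the step
`ψ(h,[x],Id)·[V] ∋ ψ(h,x,Id)·V` of Walawska–Wilczak's inclusion.
[cite: Neumaier1991, §3.1 Proposition 3.1.2 (6)] [cite: WalawskaWilczak2016, §2.1 (inclusion ψ(t_k+h_k, X₀, V₀) ⊂ ψ(h_k, X_k, Id)·V_k over interval sets)] -/
theorem comp_single_mem_imatmul {AA MM : ι → ι → NonemptyInterval ℝ}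
    {A M : (ι → ℝ) →L[ℝ] (ι → ℝ)} (hA : ∀ i l, A (Pi.single l 1) i ∈ AA i l)
    (hM : ∀ i l, M (Pi.single l 1) i ∈ MM i l) (i l : ι) :
    (A.comp M) (Pi.single l 1) i ∈ imatmul AA MM i l := by
  rw [clm_comp_apply_single]
  exact matmul_mem_imatmul (a := fun i k => A (Pi.single k 1) i)
    (b := fun k l => M (Pi.single l 1) k) (fun i k => hA i k) (fun k l => hM k l) i l

end Matrix

/-! ### Composition of C¹ enclosures over a validated step -/

section Step

variable {ι : Type*} [Fintype ι] [DecidableEq ι] {Ω : Opens (ι → ℝ)} {f : (ι → ℝ) → ι → ℝ}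
  (hf : ContDiffOn ℝ ∞ f (Ω : Set (ι → ℝ)))

include hf in
omit [DecidableEq ι] in
/-- The derivative of a field smooth on the open `Ω` is bounded on a box `S ⊆ Ω`. [folklore] -/
private theorem exists_bound_fderiv_boxSet {S : ι → NonemptyInterval ℝ} (hSΩ : boxSet S ⊆ Ω) :
    ∃ M : ℝ, ∀ z ∈ boxSet S, ‖fderiv ℝ f z‖ ≤ M :=
  (isCompact_boxSet S).exists_bound_of_continuousOn
    (((contDiffOn_infty_iff_fderiv_of_isOpen Ω.isOpen).1 hf).2.continuousOn.mono hSΩ)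

/-- **`ψ(t, x, M) = ψ(t, x, Id) · M` over a validated `C¹` step** (Walawska–Wilczak 2016 §2.1;
Teschl 2012 §3.4 (3.88)).  Under the hypotheses of
`variationalEnclosure_step_intervalTest_smoothOn_local` — the `C¹` high-order enclosure test
passed from the box data with initial matrix `Id` — for every `x ∈ W` and EVERY initial
operator `M`: the variational system `y' = f(y)`, `V' = Df(y) ∘ V`, `y(0) = x`, `V(0) = M` has a
solution on `[0, h]`, and every solution pair `(z̃, J̃)` from `(x, M)` satisfies, for all
`t ∈ [0, h]`: `z̃ t ∈ S` and `J̃ t = J ∘ M` for an operator `J` (namely `ψ(t, x, Id)`) with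
entries in `VV` and `J = ∑_{j<K} t^j Φ_j'(x) + t^K N`, `N ∈ NN` entrywise.  ("It is sufficient
to use `Id` as an initial condition for the variational equations when computing a rough
enclosure.") [cite: WalawskaWilczak2016, §2.1 (linearity identity; Id suffices for the rough enclosure)]
[cite: Teschl2012, §3.4 Theorem 3.9 and eq. (3.88)] [cite: Zgliczynski2002C1Lohner] -/
theorem variationalEnclosure_comp_intervalTest_smoothOn_local {K : ℕ} (hK : 0 < K) {h : ℝ}
    (hh : 0 ≤ h) {T : NonemptyInterval ℝ} (hT : ∀ t ∈ Icc 0 h, t ∈ T)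
    (W S V : ι → NonemptyInterval ℝ) (E : ℕ → ι → NonemptyInterval ℝ)
    (EV : ℕ → ι → ι → NonemptyInterval ℝ) (AK VV NN : ι → ι → NonemptyInterval ℝ)
    (hSΩ : boxSet S ⊆ Ω)
    (hE : ∀ j < K, MapsTo (smoothTaylorMap hf j) (boxSet W) (boxSet (E j)))
    (hV : MapsTo (smoothTaylorMap hf K) (boxSet S) (boxSet V)) (htest : hoeBox T E V K ≤ S)
    (hEV : ∀ j < K, ∀ x ∈ boxSet W, ∀ i l, smoothTaylorFDeriv hf j x (Pi.single l 1) i ∈ EV j i l)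
    (hAK : ∀ z ∈ boxSet S, ∀ i l, smoothTaylorFDeriv hf K z (Pi.single l 1) i ∈ AK i l)
    (hNN : imatmul AK VV ≤ NN) (htestV : hoeMatBox T EV NN K ≤ VV)
    {x : ι → ℝ} (hx : x ∈ boxSet W) (M : (ι → ℝ) →L[ℝ] (ι → ℝ)) :
    (∃ y : ℝ → ι → ℝ, ∃ V' : ℝ → (ι → ℝ) →L[ℝ] (ι → ℝ), y 0 = x ∧ V' 0 = M ∧
      (∀ t ∈ Icc 0 h, HasDerivWithinAt y (f (y t)) (Icc 0 h) t) ∧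
      ∀ t ∈ Icc 0 h, HasDerivWithinAt V' ((fderiv ℝ f (y t)).comp (V' t)) (Icc 0 h) t) ∧
    ∀ (z : ℝ → ι → ℝ) (J : ℝ → (ι → ℝ) →L[ℝ] (ι → ℝ)), z 0 = x → J 0 = M →
      (∀ t ∈ Icc 0 h, HasDerivWithinAt z (f (z t)) (Icc 0 h) t) →
      (∀ t ∈ Icc 0 h, HasDerivWithinAt J ((fderiv ℝ f (z t)).comp (J t)) (Icc 0 h) t) →
      ∀ t ∈ Icc 0 h, z t ∈ boxSet S ∧
        ∃ J₁ : (ι → ℝ) →L[ℝ] (ι → ℝ), J t = J₁.comp M ∧ (∀ i l, J₁ (Pi.single l 1) i ∈ VV i l) ∧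
          (∀ i l, J₁ (Pi.single l 1) i ∈ hoeMatBox T EV NN K i l) ∧
          ∃ N : (ι → ℝ) →L[ℝ] (ι → ℝ), (∀ i l, N (Pi.single l 1) i ∈ NN i l) ∧
            J₁ = (∑ j ∈ Finset.range K, t ^ j • smoothTaylorFDeriv hf j x) + t ^ K • N := by
  obtain ⟨⟨y, V', hy0, hV0, hy, hV'⟩, hall⟩ :=
    variationalEnclosure_step_intervalTest_smoothOn_local hf hK hh hT W S V E EV AK VV NN hSΩ hE
      hV htest hEV hAK hNN htestV hx
  -- state enclosure of every solution from `x` (the C⁰ test) and uniqueness along `y`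
  have hstate := (highOrderEnclosure_step_intervalTest_smoothOn_local hf hK hh hT W S V E hSΩ hE
    hV htest hx).2
  have hyS : ∀ t ∈ Icc 0 h, y t ∈ boxSet S := fun t ht => (hstate y hy0 hy t ht).1
  obtain ⟨Mb, hMb⟩ := exists_bound_fderiv_boxSet hf hSΩ
  refine ⟨⟨y, fun t => (V' t).comp M, hy0, ?_, hy, linearODE_comp_const hV' M⟩, ?_⟩
  · simp only [hV0, ContinuousLinearMap.one_def, ContinuousLinearMap.id_comp]
  intro z J hz0 hJ0 hz hJ t ht
  have hzS : ∀ s ∈ Icc 0 h, z s ∈ boxSet S := fun s hs => (hstate z hz0 hz s hs).1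
  -- `y = z` on `[0, h]`
  have hyz : EqOn y z (Icc 0 h) :=
    ODE_solution_unique_of_lipschitzOnWith_nhds
      (fun s hs => exists_lipschitzOnWith_nhds_of_contDiffOn Ω.isOpen hf (hSΩ (hyS s hs))) hy hz
      (hy0.trans hz0.symm)
  -- `V'` solves the linear equation along `z`, whose coefficients are bounded on `[0, h]`
  have hV'z : ∀ s ∈ Icc 0 h,
      HasDerivWithinAt V' ((fderiv ℝ f (z s)).comp (V' s)) (Icc 0 h) s := fun s hs => by
    rw [← hyz hs]; exact hV' s hs
  have hA : ∀ s ∈ Ico 0 h, ‖fderiv ℝ f (z s)‖ ≤ Mb := fun s hs =>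
    hMb _ (hzS s (Ico_subset_Icc_self hs))
  have hJt : J t = (V' t).comp M := by
    have h1 := linearODE_eq_comp hV'z hV0 hJ hA t ht
    rwa [hJ0] at h1
  obtain ⟨-, hVV, N, hN, hVt⟩ := hall y V' hy0 hV0 hy hV' t ht
  exact ⟨hzS t ht, V' t, hJt, hVV, variationalEnclosure_jacobian_tube_smoothOn_local hf hK hh hT
    W S V E EV AK VV NN hSΩ hE hV htest hEV hAK hNN htestV hx hy0 hV0 hy hV' ht, N, hN, hVt⟩

/-- **Composition of `C¹` enclosures by the interval matrix product**
(Walawska–Wilczak 2016 §2.1: `ψ(t_k + h_k, [x₀], [V₀]) ⊂ ψ(h_k, [x_k], Id) · [V_k]`).  Under the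
hypotheses of `variationalEnclosure_step_intervalTest_smoothOn_local`, if the initial operator
`M` has entries in the interval matrix `MM`, then every solution pair `(z̃, J̃)` from `(x, M)`,
`x ∈ W`, satisfies for all `t ∈ [0, h]`: `z̃ t ∈ S`, `J̃ t ∈ VV · MM` and
`J̃ t ∈ (∑_{j<K} T^j EV_j + T^K NN) · MM`, entrywise (interval matrix products).
[cite: WalawskaWilczak2016, §2.1 (inclusion ψ(t_k+h_k, X₀, V₀) ⊂ ψ(h_k, X_k, Id)·V_k over interval sets)]
[cite: Neumaier1991, §3.1 Proposition 3.1.2 (6)] [cite: Teschl2012, §3.4 eq. (3.88)] -/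
theorem variationalEnclosure_comp_imatmul_smoothOn_local {K : ℕ} (hK : 0 < K) {h : ℝ}
    (hh : 0 ≤ h) {T : NonemptyInterval ℝ} (hT : ∀ t ∈ Icc 0 h, t ∈ T)
    (W S V : ι → NonemptyInterval ℝ) (E : ℕ → ι → NonemptyInterval ℝ)
    (EV : ℕ → ι → ι → NonemptyInterval ℝ) (AK VV NN : ι → ι → NonemptyInterval ℝ)
    (hSΩ : boxSet S ⊆ Ω)
    (hE : ∀ j < K, MapsTo (smoothTaylorMap hf j) (boxSet W) (boxSet (E j)))
    (hV : MapsTo (smoothTaylorMap hf K) (boxSet S) (boxSet V)) (htest : hoeBox T E V K ≤ S)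
    (hEV : ∀ j < K, ∀ x ∈ boxSet W, ∀ i l, smoothTaylorFDeriv hf j x (Pi.single l 1) i ∈ EV j i l)
    (hAK : ∀ z ∈ boxSet S, ∀ i l, smoothTaylorFDeriv hf K z (Pi.single l 1) i ∈ AK i l)
    (hNN : imatmul AK VV ≤ NN) (htestV : hoeMatBox T EV NN K ≤ VV)
    {x : ι → ℝ} (hx : x ∈ boxSet W) {MM : ι → ι → NonemptyInterval ℝ}
    {M : (ι → ℝ) →L[ℝ] (ι → ℝ)} (hM : ∀ i l, M (Pi.single l 1) i ∈ MM i l)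
    {z : ℝ → ι → ℝ} {J : ℝ → (ι → ℝ) →L[ℝ] (ι → ℝ)} (hz0 : z 0 = x) (hJ0 : J 0 = M)
    (hz : ∀ t ∈ Icc 0 h, HasDerivWithinAt z (f (z t)) (Icc 0 h) t)
    (hJ : ∀ t ∈ Icc 0 h, HasDerivWithinAt J ((fderiv ℝ f (z t)).comp (J t)) (Icc 0 h) t)
    {t : ℝ} (ht : t ∈ Icc 0 h) :
    z t ∈ boxSet S ∧ (∀ i l, J t (Pi.single l 1) i ∈ imatmul VV MM i l) ∧
      ∀ i l, J t (Pi.single l 1) i ∈ imatmul (hoeMatBox T EV NN K) MM i l := by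
  obtain ⟨hzS, J₁, hJt, hVV, htube, -⟩ := (variationalEnclosure_comp_intervalTest_smoothOn_local
    hf hK hh hT W S V E EV AK VV NN hSΩ hE hV htest hEV hAK hNN htestV hx M).2 z J hz0 hJ0 hz hJ
    t ht
  refine ⟨hzS, fun i l => ?_, fun i l => ?_⟩
  · rw [hJt]; exact comp_single_mem_imatmul hVV hM i l
  · rw [hJt]; exact comp_single_mem_imatmul htube hM i l

end Step

/-! ### Polynomial fields: all data by natural interval extension -/

section Polynomial

variable {ι : Type*} [Fintype ι] [DecidableEq ι]

/-- **Composition of `C¹` enclosures for a polynomial field, all interval data computed by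
natural interval extension** (Walawska–Wilczak 2016 §2.1).  If the two containments
`∑_{j<K} T^j·polyBoxVec W (taylorPoly p j) + T^K·polyBoxVec S (taylorPoly p K) ⊆ S` and
`∑_{j<K} T^j·jacPolyBox W (taylorPoly p j) + T^K·(jacPolyBox S (taylorPoly p K) · VV) ⊆ VV`
hold (the `C¹` HOE test with initial matrix `Id`), then for every `x ∈ W` and every initial
operator `M` with entries in `MM`, every solution pair `(z̃, J̃)` of `y' = p(y)`,
`V' = Dp(y) ∘ V` from `(x, M)` satisfies `z̃ t ∈ S`, `J̃ t ∈ VV · MM` and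
`J̃ t ∈ (∑_{j<K} T^j EV_j + T^K NN) · MM` (`EV_j`, `NN` the computed interval matrices),
entrywise, for all `t ∈ [0, h]`.
[cite: WalawskaWilczak2016, §2.1 (inclusion ψ(t_k+h_k, X₀, V₀) ⊂ ψ(h_k, X_k, Id)·V_k over interval sets; C¹ high-order enclosure)]
[cite: Moore1979, §3.3 Corollary 3.1 and §8.1 eq. (8.10)] [cite: Neumaier1991, §3.1 Proposition 3.1.2 (6)] -/
theorem variationalEnclosure_comp_naturalExtension_polynomial (p : ι → MvPolynomial ι ℝ)
    {K : ℕ} (hK : 0 < K) {h : ℝ} (hh : 0 ≤ h) {T : NonemptyInterval ℝ}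
    (hT : ∀ t ∈ Icc 0 h, t ∈ T) (W S : ι → NonemptyInterval ℝ) (VV : ι → ι → NonemptyInterval ℝ)
    (htest : hoeBox T (fun j => polyBoxVec W (taylorPoly p j)) (polyBoxVec S (taylorPoly p K)) K
      ≤ S)
    (htestV : hoeMatBox T (fun j => jacPolyBox W (taylorPoly p j))
      (imatmul (jacPolyBox S (taylorPoly p K)) VV) K ≤ VV)
    {x : ι → ℝ} (hx : x ∈ boxSet W) {MM : ι → ι → NonemptyInterval ℝ}
    {M : (ι → ℝ) →L[ℝ] (ι → ℝ)} (hM : ∀ i l, M (Pi.single l 1) i ∈ MM i l)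
    {z : ℝ → ι → ℝ} {J : ℝ → (ι → ℝ) →L[ℝ] (ι → ℝ)} (hz0 : z 0 = x) (hJ0 : J 0 = M)
    (hz : ∀ t ∈ Icc 0 h, HasDerivWithinAt z (evalVec p (z t)) (Icc 0 h) t)
    (hJ : ∀ t ∈ Icc 0 h, HasDerivWithinAt J ((evalVecFDeriv p (z t)).comp (J t)) (Icc 0 h) t)
    {t : ℝ} (ht : t ∈ Icc 0 h) :
    z t ∈ boxSet S ∧ (∀ i l, J t (Pi.single l 1) i ∈ imatmul VV MM i l) ∧
      ∀ i l, J t (Pi.single l 1) i ∈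
        imatmul (hoeMatBox T (fun j => jacPolyBox W (taylorPoly p j))
          (imatmul (jacPolyBox S (taylorPoly p K)) VV) K) MM i l := by
  have hf := contDiffOn_evalVec_top p
  have hE' : ∀ j < K, MapsTo (smoothTaylorMap hf j) (boxSet W)
      (boxSet (polyBoxVec W (taylorPoly p j))) := fun j hj => by
    rw [smoothTaylorMap_polynomial]; exact mapsTo_taylorMap_polyBoxVec p j W
  have hV' : MapsTo (smoothTaylorMap hf K) (boxSet S) (boxSet (polyBoxVec S (taylorPoly p K))) := by
    rw [smoothTaylorMap_polynomial]; exact mapsTo_taylorMap_polyBoxVec p K S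
  have hEV' : ∀ j < K, ∀ x ∈ boxSet W, ∀ i l,
      smoothTaylorFDeriv hf j x (Pi.single l 1) i ∈ jacPolyBox W (taylorPoly p j) i l :=
    fun j hj x hx i l => by
    rw [smoothTaylorFDeriv_polynomial]; exact evalVecFDeriv_single_mem_jacPolyBox _ hx i l
  have hAK' : ∀ z ∈ boxSet S, ∀ i l,
      smoothTaylorFDeriv hf K z (Pi.single l 1) i ∈ jacPolyBox S (taylorPoly p K) i l :=
    fun z hz i l => by
    rw [smoothTaylorFDeriv_polynomial]; exact evalVecFDeriv_single_mem_jacPolyBox _ hz i l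
  have hJ' : ∀ t ∈ Icc 0 h,
      HasDerivWithinAt J ((fderiv ℝ (evalVec p) (z t)).comp (J t)) (Icc 0 h) t := by
    rw [fderiv_evalVec]; exact hJ
  exact variationalEnclosure_comp_imatmul_smoothOn_local hf hK hh hT W S
    (polyBoxVec S (taylorPoly p K)) (fun j => polyBoxVec W (taylorPoly p j))
    (fun j => jacPolyBox W (taylorPoly p j)) (jacPolyBox S (taylorPoly p K)) VV
    (imatmul (jacPolyBox S (taylorPoly p K)) VV) (fun _ _ => trivial) hE' hV' htest hEV' hAK'
    le_rfl htestV hx hM hz0 hJ0 hz hJ' ht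

end Polynomial

end Literature.Analysis.ODE

end
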